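import Summits.NavierStokesRegularity.NavierStokesRegularity.Theses.AxisymmetricExtremality
import Summits.NavierStokesRegularity.NavierStokesRegularity.Theorems.AxisymmetricExtremalityAxisymmetricKatoGlobalReduction
import HarnessLib.Audit

/-!
# Strategist census signatures — crux `AxisymmetricExtremality.AxisymmetricKatoGlobal`
(stmt-NavierStokesRegularity-15453), seat `cstrat-…-s19-g11` (family `s`, gen 11, independent census).

Nothing here is a registered line.  The file TYPES the census attempts so that the verdict
`no-strategy-short-of-summit` rests on checked signatures:

* §1 `NoAxisymMinimalDatum` (W1) — the weakest statement that can replace the crux in the route's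
  deciding theorem: `closes_of_noAxisymMinimalDatum` re-proves `closes` with W1 in place of the crux
  (sorry-free), `noAxisymMinimalDatum_of_crux` shows crux ⇒ W1 (sorry-free).  The converse is not
  provable: W1 also follows from "symmetric blow-up is never the cheapest" (ρ_ax > ρ_max), for which
  no mechanism exists; modulo that, W1 is the crux restricted to threshold data, and
  Ḣ^{1/2}-minimality of the DATUM gives no scale-critical control at the axis.
* §2 the swirl-continuity split (D3): `SwirlVanishesAtAxisNearTop` (i′: Γ → 0 at the axis
  uniformly up to the final time, NO RATE) and `AxisRegularOfVanishingSwirl` (ii′: an axis point is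
  bounded-near-top if Γ → 0 uniformly at the axis — the Lei–Zhang "critical case", no rate) with the
  sorry-free composition `AxisymmetricKatoGlobal_of_swirlContinuity : (i′) → (ii′) → crux` (stub 1 of
  the registered skeleton and the off-axis half are LANDED theorems, used by name), and the two
  sorry-free comparison lemmas placing the pieces against the registered cut:
  `swirlVanishes_of_logModulus : stub_swirlAxisModulus-statement → (i′)` (i′ is WEAKER than the open
  registered stub) and `logCriterionAtAxis_of_axisRegular : (ii′) → (log³ criterion at axis points)`
  (ii′ is STRONGER than the known Seregin-2022 criterion).  Both pieces are open; see the census.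
-/

noncomputable section

set_option linter.dupNamespace false
set_option linter.unusedVariables false

open Set MeasureTheory Filter Topology Function Metric
open scoped ENNReal NNReal
open Literature.Analysis.FluidPDE Literature.Analysis.FunctionSpaces
open Summit.NavierStokesRegularity.NavierStokesRegularity.Theses.AxisymmetricExtremality
open Summit.NavierStokesRegularity.NavierStokesRegularity.Theorems.AxisymmetricKatoGlobal.Registered

namespace Summit.NavierStokesRegularity.NavierStokesRegularity.Cruxes.AxisymmetricKatoGlobal.StrategistS19g11

local notation "ℝ³" => EuclideanSpace ℝ (Fin 3)

/-! ## §1  The weakest replacement of the crux in `closes` -/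

/-- **W1 — no axisymmetric minimal blow-up datum.**  For every `ν > 0`, no Rusin–Šverák
`Ḣ^{1/2}`-minimal blow-up datum is axisymmetric (rotation-equivariance written out exactly as in the
route file, i.e. `IsAxisymmetric u₀` unfolded).  This is the ONLY instance of the crux that the
route's deciding theorem consumes. -/
def NoAxisymMinimalDatum : Prop :=
  ∀ ν : ℝ, 0 < ν → ∀ (u₀ : ℝ³ → ℝ³) (g : HomSobolev ℝ³ (EuclideanSpace ℂ (Fin 3)) (1 / 2 : ℝ)),
    IsMinimalBlowupDatum ν u₀ g →
    (∀ (θ : ℝ) (x : ℝ³), u₀ (WithLp.toLp 2 ![Real.cos θ * x 0 - Real.sin θ * x 1,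
        Real.sin θ * x 0 + Real.cos θ * x 1, x 2]) =
      WithLp.toLp 2 ![Real.cos θ * u₀ x 0 - Real.sin θ * u₀ x 1,
        Real.sin θ * u₀ x 0 + Real.cos θ * u₀ x 1, u₀ x 2]) → False

/-- crux ⇒ W1 (trivial direction). -/
theorem noAxisymMinimalDatum_of_crux (h : AxisymmetricKatoGlobal) : NoAxisymMinimalDatum := by
  intro ν hν u₀ g hmin hax
  obtain ⟨hL3, hrep, hdiv, -, hnot⟩ := hmin
  exact hnot (h ν hν u₀ g hL3 hrep hdiv hax)

/-- The route's deciding theorem goes through VERBATIM with W1 in place of the crux. -/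
theorem closes_of_noAxisymMinimalDatum (h₂ : MinimalDatumPFold) (h₄ : PFoldToAxisymmetric)
    (hW : NoAxisymMinimalDatum) : _root_.NavierStokesRegularity := by
  show Literature.NS.NavierStokesExistenceSmoothR3
  intro ν hν u₀ hsm hdiv hdec
  by_contra hno
  obtain ⟨u₁, g, hmin, hax⟩ := h₄ ν hν (h₂ ν hν ⟨u₀, hsm, hdiv, hdec, hno⟩)
  exact hW ν hν u₁ g hmin hax

/-! ## §2  The swirl-continuity split (D3) and its position relative to the registered cut -/

/-- **(i′) `SwirlVanishesAtAxisNearTop`** — a-priori side, NO RATE: for an axisymmetric Kato solution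
on `[0,T)` from an `L³` datum represented in `Ḣ^{1/2}`, smooth on `(0,T) × ℝ³`, the swirl
`Γ = swirl (u t)` tends to `0` at the axis uniformly in `t ∈ [t₀, T)` for every `0 < t₀ < T`
(`∀ ε > 0 ∃ δ₁ > 0, cylRadius x ≤ δ₁ ⇒ |Γ(t,x)| ≤ ε`).  Same binders as the registered
`stub_swirlAxisModulus`, conclusion weakened from `C/|log r|³` to `o(1)`.  OPEN at `T = T_max`. -/
def SwirlVanishesAtAxisNearTop : Prop :=
  ∀ ν : ℝ, 0 < ν → ∀ T : ℝ, 0 < T → ∀ (u₀ : ℝ³ → ℝ³)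
    (g : HomSobolev ℝ³ (EuclideanSpace ℂ (Fin 3)) (1 / 2 : ℝ)) (u : ℝ → ℝ³ → ℝ³),
    g.Represents (Literature.Analysis.FunctionSpaces.EuclideanSpace.complexify ∘ u₀) →
    IsKatoSolutionOn T ν u₀ u → ContDiffOn ℝ (⊤ : ℕ∞) (uncurry u) (Ioo 0 T ×ˢ univ) →
    (∀ t ∈ Ioo 0 T, IsAxisymmetric (u t)) →
    ∀ t₀ ∈ Ioo 0 T, ∀ ε : ℝ, 0 < ε → ∃ δ₁ : ℝ, 0 < δ₁ ∧
      ∀ t ∈ Ico t₀ T, ∀ x : ℝ³, cylRadius x ≤ δ₁ → |swirl (u t) x| ≤ ε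

/-- **(ii′) `AxisRegularOfVanishingSwirl`** — criterion side, NO RATE (the Lei–Zhang "critical
case", made local and stated in the Kato class): an axisymmetric Kato solution on `[0,T)`, smooth on
`(0,T) × ℝ³`, whose swirl tends to `0` at the axis uniformly on some `[t₀,T)`, is bounded near
`(T, x₀)` at every AXIS point `x₀` (`cylRadius x₀ = 0`; off-axis points are handled by the landed
`stub_offAxisBounded_of_localEnergy`).  OPEN: every printed criterion needs a rate
(`|log r|^{-3/2}`, Wei 2016) or data-relative smallness. -/
def AxisRegularOfVanishingSwirl : Prop :=
  ∀ ν : ℝ, 0 < ν → ∀ T : ℝ, 0 < T → ∀ (u₀ : ℝ³ → ℝ³) (u : ℝ → ℝ³ → ℝ³),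
    IsKatoSolutionOn T ν u₀ u → ContDiffOn ℝ (⊤ : ℕ∞) (uncurry u) (Ioo 0 T ×ˢ univ) →
    (∀ t ∈ Ioo 0 T, IsAxisymmetric (u t)) →
    (∃ t₀ ∈ Ioo 0 T, ∀ ε : ℝ, 0 < ε → ∃ δ₁ : ℝ, 0 < δ₁ ∧
        ∀ t ∈ Ico t₀ T, ∀ x : ℝ³, cylRadius x ≤ δ₁ → |swirl (u t) x| ≤ ε) →
    ∀ x₀ : ℝ³, cylRadius x₀ = 0 → IsBoundedNearTop u T x₀

/-- **Composition of the split (sorry-free):** (i′) → (ii′) → crux.  Stub 1 of the registered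
skeleton (`stub_katoAxisymSingularPoint`, landed), the local energy near the top
(`stub_katoLocalEnergyNearTop`, landed) and the off-axis boundedness
(`stub_offAxisBounded_of_localEnergy`, landed) are used by name. -/
theorem AxisymmetricKatoGlobal_of_swirlContinuity
    (hI : SwirlVanishesAtAxisNearTop) (hII : AxisRegularOfVanishingSwirl) :
    AxisymmetricKatoGlobal := by
  intro ν hν u₀ g hL3 hrep hdiv hax
  have hax' : IsAxisymmetric u₀ := fun θ x => hax θ x
  by_contra hng
  obtain ⟨T, hT, xs, u, hK, hsm, haxi, hsing⟩ :=
    stub_katoAxisymSingularPoint ν hν u₀ hL3 hdiv hax' hng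
  have ht₀ : T / 2 ∈ Ioo 0 T := ⟨by linarith, by linarith⟩
  have hmod := hI ν hν T hT u₀ g u hrep hK hsm haxi (T / 2) ht₀
  have hbdd : IsBoundedNearTop u T xs := by
    by_cases h0 : cylRadius xs = 0
    · exact hII ν hν T hT u₀ u hK hsm haxi ⟨T / 2, ht₀, hmod⟩ xs h0
    · obtain ⟨p, hpax, hsw, hloc⟩ := stub_katoLocalEnergyNearTop ν hν T hT u₀ u hK hsm haxi
      exact stub_offAxisBounded_of_localEnergy ν hν T hT u p hsm haxi hsw hloc xs h0
  obtain ⟨r, hr, K, hbd⟩ := hbdd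
  exact absurd (hsing r hr) (eLpNorm_parabolicCylinder_lt_top_of_forall_le hbd).ne

/-- Elementary: a `C/|log ρ|³` bound below `δ₀ < 1` gives smallness `≤ ε` below some `δ₁ > 0`
(`Real.log 0 = 0` makes the `ρ = 0` case read `|Γ| ≤ 0`). -/
theorem small_of_logModulus {ι : Type*} (Γ ρ : ι → ℝ) (hρ : ∀ i, 0 ≤ ρ i)
    {C δ₀ : ℝ} (hδ₀ : 0 < δ₀) (hδ₁ : δ₀ < 1)
    (h : ∀ i, ρ i ≤ δ₀ → |Γ i| ≤ C / |Real.log (ρ i)| ^ 3) :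
    ∀ ε : ℝ, 0 < ε → ∃ δ₁ : ℝ, 0 < δ₁ ∧ ∀ i, ρ i ≤ δ₁ → |Γ i| ≤ ε := by
  intro ε hε
  set L : ℝ := max 1 (C / ε) with hL
  refine ⟨min δ₀ (Real.exp (-L)), lt_min hδ₀ (Real.exp_pos _), fun i hi => ?_⟩
  have hiδ₀ : ρ i ≤ δ₀ := hi.trans (min_le_left _ _)
  have hb := h i hiδ₀
  rcases (hρ i).eq_or_lt with h0 | hpos
  · rw [← h0, Real.log_zero, abs_zero, zero_pow three_ne_zero, div_zero] at hb
    exact hb.trans hε.le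
  · by_cases hC : C ≤ 0
    · exact hb.trans ((div_nonpos_of_nonpos_of_nonneg hC (by positivity)).trans hε.le)
    · rw [not_le] at hC
      have hle : ρ i ≤ Real.exp (-L) := hi.trans (min_le_right _ _)
      have hlog : Real.log (ρ i) ≤ -L := by
        have := Real.log_le_log hpos hle
        rwa [Real.log_exp] at this
      have hL1 : 1 ≤ L := le_max_left _ _
      have hLC : C / ε ≤ L := le_max_right _ _
      have habs : L ≤ |Real.log (ρ i)| := by
        rw [abs_of_nonpos (by linarith)]
        linarith
      have h1abs : 1 ≤ |Real.log (ρ i)| := hL1.trans habs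
      have hpow : |Real.log (ρ i)| ≤ |Real.log (ρ i)| ^ 3 := by
        calc |Real.log (ρ i)| = |Real.log (ρ i)| ^ 1 := (pow_one _).symm
          _ ≤ |Real.log (ρ i)| ^ 3 := pow_le_pow_right₀ h1abs (by norm_num)
      have hden : C / ε ≤ |Real.log (ρ i)| ^ 3 := hLC.trans (habs.trans hpow)
      have hpos3 : 0 < |Real.log (ρ i)| ^ 3 := by positivity
      have hCle : C ≤ |Real.log (ρ i)| ^ 3 * ε := (div_le_iff₀ hε).1 hden
      have : C / |Real.log (ρ i)| ^ 3 ≤ ε := by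
        rw [div_le_iff₀ hpos3]
        linarith
      exact hb.trans this

/-- **(i′) is WEAKER than the registered open stub:** the statement of `stub_swirlAxisModulus`
(verbatim, as a hypothesis) implies `SwirlVanishesAtAxisNearTop`. -/
theorem swirlVanishes_of_logModulus
    (h3 : ∀ ν : ℝ, 0 < ν → ∀ T : ℝ, 0 < T → ∀ (u₀ : ℝ³ → ℝ³)
      (g : HomSobolev ℝ³ (EuclideanSpace ℂ (Fin 3)) (1 / 2 : ℝ)) (u : ℝ → ℝ³ → ℝ³),
      g.Represents (Literature.Analysis.FunctionSpaces.EuclideanSpace.complexify ∘ u₀) →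
      IsKatoSolutionOn T ν u₀ u → ContDiffOn ℝ (⊤ : ℕ∞) (uncurry u) (Ioo 0 T ×ˢ univ) →
      (∀ t ∈ Ioo 0 T, IsAxisymmetric (u t)) →
      ∀ t₀ ∈ Ioo 0 T, ∃ C δ₀ : ℝ, 0 < δ₀ ∧ δ₀ < 1 ∧
        ∀ t ∈ Ico t₀ T, ∀ x : ℝ³, cylRadius x ≤ δ₀ →
          |swirl (u t) x| ≤ C / |Real.log (cylRadius x)| ^ 3) :
    SwirlVanishesAtAxisNearTop := by
  intro ν hν T hT u₀ g u hrep hK hsm haxi t₀ ht₀ ε hε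
  obtain ⟨C, δ₀, hδ₀, hδ₁, hmod⟩ := h3 ν hν T hT u₀ g u hrep hK hsm haxi t₀ ht₀
  -- index set: pairs (t, x) with t ∈ [t₀, T)
  obtain ⟨δ₁, hδ₁pos, hsmall⟩ :=
    small_of_logModulus (ι := {p : ℝ × ℝ³ // p.1 ∈ Ico t₀ T})
      (fun p => swirl (u p.1.1) p.1.2) (fun p => cylRadius p.1.2)
      (fun p => cylRadius_nonneg p.1.2) hδ₀ hδ₁ (fun p hp => hmod p.1.1 p.2 p.1.2 hp) ε hε
  exact ⟨δ₁, hδ₁pos, fun t ht x hx => hsmall ⟨(t, x), ht⟩ hx⟩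

/-- **(ii′) is STRONGER than the known criterion:** `AxisRegularOfVanishingSwirl` implies the
log³-modulus criterion at axis points (the shape of the landed reduction's axis half, there derived
from the named fact `seregin2022_logSwirl_regularAtOrigin`). -/
theorem logCriterionAtAxis_of_axisRegular (hII : AxisRegularOfVanishingSwirl) :
    ∀ ν : ℝ, 0 < ν → ∀ T : ℝ, 0 < T → ∀ (u₀ : ℝ³ → ℝ³) (u : ℝ → ℝ³ → ℝ³),
      IsKatoSolutionOn T ν u₀ u → ContDiffOn ℝ (⊤ : ℕ∞) (uncurry u) (Ioo 0 T ×ˢ univ) →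
      (∀ t ∈ Ioo 0 T, IsAxisymmetric (u t)) →
      (∃ t₀ ∈ Ioo 0 T, ∃ C δ₀ : ℝ, 0 < δ₀ ∧ δ₀ < 1 ∧
          ∀ t ∈ Ico t₀ T, ∀ x : ℝ³, cylRadius x ≤ δ₀ →
            |swirl (u t) x| ≤ C / |Real.log (cylRadius x)| ^ 3) →
      ∀ x₀ : ℝ³, cylRadius x₀ = 0 → IsBoundedNearTop u T x₀ := by
  intro ν hν T hT u₀ u hK hsm haxi hmod x₀ hx₀
  obtain ⟨t₀, ht₀, C, δ₀, hδ₀, hδ₁, hmod⟩ := hmod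
  refine hII ν hν T hT u₀ u hK hsm haxi ⟨t₀, ht₀, ?_⟩ x₀ hx₀
  intro ε hε
  obtain ⟨δ₁, hδ₁pos, hsmall⟩ :=
    small_of_logModulus (ι := {p : ℝ × ℝ³ // p.1 ∈ Ico t₀ T})
      (fun p => swirl (u p.1.1) p.1.2) (fun p => cylRadius p.1.2)
      (fun p => cylRadius_nonneg p.1.2) hδ₀ hδ₁ (fun p hp => hmod p.1.1 p.2 p.1.2 hp) ε hε
  exact ⟨δ₁, hδ₁pos, fun t ht x hx => hsmall ⟨(t, x), ht⟩ hx⟩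

end Summit.NavierStokesRegularity.NavierStokesRegularity.Cruxes.AxisymmetricKatoGlobal.StrategistS19g11

end
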